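import Summits.BirchSwinnertonDyer.BirchSwinnertonDyer.Theorems.GenusKolyvaginAtTwoMinimalTwinBSDTwoKrizLiAnchorWallAdd
import Summits.BirchSwinnertonDyer.BirchSwinnertonDyer.Theorems.ByReductionTypeAtTwoAdditivePotGoodPrintKrizLi92b1Base
import Literature.NumberTheory.EllipticCurves.KrizLi2019.Table1RankOneRowsAdditiveAtTwo
import Literature.NumberTheory.EllipticCurves.OrdinaryPrimesProofs
import Literature.NumberTheory.EllipticCurves.LeadingTermTamagawaProofs
import Literature.NumberTheory.EllipticCurves.HeegnerHypothesisKroneckerProofs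
import Literature.NumberTheory.QuadraticFields.KroneckerSplitting
import Mathlib.Tactic.NormNum.LegendreSymbol
import HarnessLib

/-!
# Route `GenusKolyvaginAtTwo`, crux U₂ `MinimalTwinBSDTwo` (stmt-BirchSwinnertonDyer-22985), LINE 23 «twin_swap»: THE ADDITIVE-WALL-KEYED KRIZ–LI ROAD AT THE
# RANK-ONE ANCHOR `172a1 = [0,1,0,-13,15]` (`y² = x³ + x² − 13x + 15`; `N = 172 = 2²·43`, `Δ = -11008`, Kodaira `IV*` at `2`, `c₂ = 3`; Kriz–Li Table 1 row `172a1 | -7 | 3 | ✓`)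
# OVER `K = ℚ(√-7)` — KERNEL BASE DATA (the road is `…KrizLiAnchor172a1.lean`) for `BSD(·, 2)` on the whole packet `{172a1^{(d)}, 172a1^{(-7d)} : d ∈ 𝒩(172a1, K), χ_d(−172) = 1}` from the
# PRINTED Table-1 row, Kriz–Li Thm 5.1 (2) / 4.3, Creutz–Miller on the base (`N = 172`), the ARS Manin input, and the ADDITIVE wall row (19098) on the rank-zero companion `172a1^{(-7)}`
# (`N = 8428 > 5000`, outside Creutz–Miller); witness `d = -11`: members `172a1^{(-11)}` (rank 1, `N = 20812`), `172a1^{(77)}` (rank 0)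

Seat `bsd-line-gk2-p2` g34 (PROVER 2/3, cell `bsd-f1-sign2`; LINE 23 holder), `--supports stmt-BirchSwinnertonDyer-22985` (helper; closes nothing).
THEOREMS ONLY (0 `def`, 0 `sorry`); standard axioms.  HONEST FRAMING (D-0014/D-0036): instance of the base-generic additive-wall-keyed road
`KrizLiAnchorWall.krizLi_bsdp_two_of_twist_of_conductor_lt_of_addWall` (this seat, `…KrizLiAnchorWallAdd.lean`) at `V = 172a1` — the U₂-side twin of the
K4 seat's `…PrintKrizLi92b1.lean` with the companion's `BSD(2)` from the additive wall row instead of Creutz–Miller.  CONDITIONAL on displayed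
named facts: PRINT — Kriz–Li 2019 Thm 5.1 (2) (`thm112_bsdTwo_twist`), Thm 4.3 (`thm33_rank_twist`), the Table-1 row (`table1_row172a1`), Creutz–Miller /
Miller (`bsdTriple_of_analyticRank_le_one_of_conductor_lt` at `N = 172`), Gross–Zagier–Kolyvagin (`rank_eq_analyticRank_of_analyticRank_le_one`, for
`r_an(172a1) = 1` from Thm 4.3 + the kernel point) , Agashe–Ribet–Stein Thm. 2.6 (`cremona_abs_maninConstant_eq_one_of_level_le`: the OPTIMAL datum of the Table-1
row has odd Manin constant) — and the RESEARCH input = the ADDITIVE rank-zero wall row (item 19098 unfolded: `BSD₂` for every non-CM `r_an = 0` curve additive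
at `2`, displayed as `hAdd`), which pays the companion `172a1^{(-7)}` (non-CM, `r_an = 0` by Thm 4.3, additive at `2` by the unramified-twist transport).  Kernel (§1): global minimality, `E[2]` irreducible (the `2`-division cubic has no root mod `11`), Kodaira `IV*` at `2` by a DeepCert certificate
(`f₂ = 2`, `c₂ ∣ 3` odd), additive potentially good at `2` (`ord₂ j = 13`), non-CM (multiplicative at `43`), `N = 172 = 2²·43` exactly, the point `2·P` of infinite order (denominator divisible
by `3`), the Heegner hypothesis for `(172, -7)`, the witness `#Ẽ(𝔽_11) = 15` (`a_11` odd).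
WHAT THIS SAYS FOR U₂: `rankOneMembers_172A1` — at every global minimal `W₁ ≅ 172a1^{(d)}`, `d ∈ 𝒩`, `χ_d(−172) = 1`: `r_an(W₁) = 1 ∧ ¬CM ∧ BSDp W₁ 2`
MODULO THE ADDITIVE WALL ROW + PRINT (no LINE 23 research stub); companions `r_an = 0 ∧ ¬CM ∧ Addv ∧ BSDp`.  Beyond-print theorem: no.  **BSD is NOT proved by any of this;
U₂ is NOT proved; the wall is OPEN; no item is closed.**  References: [KrizLi2019] Thm 5.1 (2), Thm 4.3, Def 4.1, §6 Ex. 6.2, Table 1 (row 172a1,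
arXiv:1606.03172v3 Congruence.tex l. 992); [CreutzMiller2012] Thm 1.1; [Miller2011LMS] Def 1.1; [CremonaAlgorithms1997] Table 1 (172A1);
[AgasheRibetStein2006] Thm. 2.6; [Silverman1994] IV.9.4; [SilvermanAEC2009] III.2.3, VII.1, VII.3.4, VII.5, X.5, App. C §11; [Kraus1989] Prop. 1–2.
-/

set_option autoImplicit false
-- the Theorems namespace of this sub repeats the summit name by design (D-0017 nested layout)
set_option linter.dupNamespace false

noncomputable section

open scoped Classical NumberField

open WeierstrassCurve IsDedekindDomain Rat.HeightOneSpectrum NumberField Literature.NumberTheory.EllipticCurves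
  Literature.NumberTheory.EllipticCurves.ModularForms
  Literature.NumberTheory.EllipticCurves.Rank1Residual
  Literature.NumberTheory.EllipticCurves.Rank1Residual.Typed
  Literature.NumberTheory.DiophantineGeometry
  Summit.BirchSwinnertonDyer
  Summit.BirchSwinnertonDyer.Rank1Residual
  Summit.BirchSwinnertonDyer.Rank1Residual.X11b
  Summit.BirchSwinnertonDyer.Rank1Residual.X5.O1
  Summit.BirchSwinnertonDyer.Rank1Residual.P2
  Summit.BirchSwinnertonDyer.BirchSwinnertonDyer.Rank1Residual.IntModel
  Summit.BirchSwinnertonDyer.BirchSwinnertonDyer.Theorems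
  Summit.BirchSwinnertonDyer.BirchSwinnertonDyer.Theorems.AddPotGoodPrint
  Summit.BirchSwinnertonDyer.BirchSwinnertonDyer.Theorems.GenusExact.TwinSwap.KrizLiAnchorWall
  Summit.BirchSwinnertonDyer.BirchSwinnertonDyer.Rank2Observatory.Tate
  Literature.NumberTheory.EllipticCurves.AgasheRibetStein2006

namespace Summit.BirchSwinnertonDyer.BirchSwinnertonDyer.Theorems.GenusExact.TwinSwap.KrizLiAnchor172a1

/-! ## §1 The anchor `172a1 = [0, 1, 0, -13, 15]`: `Δ = -11008`, `c₄ = 640`, `IV*` at `2`, multiplicative at `43` -/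
section Base172A1

/-- `172a1` is an elliptic curve (`Δ = -11008 ≠ 0`). [cite: CremonaAlgorithms1997, Table 1 (172A1)] -/
theorem isElliptic_172A1 : (⟨0, 1, 0, -13, 15⟩ : WeierstrassCurve ℚ).IsElliptic := ⟨by
  rw [isUnit_iff_ne_zero]; norm_num [WeierstrassCurve.Δ, WeierstrassCurve.b₂, WeierstrassCurve.b₄, WeierstrassCurve.b₆, WeierstrassCurve.b₈]⟩

/-- `172a1` is GLOBALLY MINIMAL (`|Δ| = 2^8·43^1`: `v_p Δ < 12` everywhere). [cite: SilvermanAEC2009, VII.1 Remark 1.1] [cite: Kraus1989, Prop. 1 and Prop. 2] -/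
theorem isGloballyMinimal_172A1 : (⟨0, 1, 0, -13, 15⟩ : WeierstrassCurve ℚ).IsGloballyMinimal :=
  isGloballyMinimal_of_krausCriterion_support (0) (1) (0) (-13) (15) [(2, 0, 8), (43, 0, 1)]
    (by intro t ht; simp only [List.mem_cons, List.not_mem_nil, or_false] at ht
        rcases ht with rfl | rfl <;> norm_num)
    (by decide +kernel) (by decide +kernel)

/-- `Δ(172a1) = -11008` on the integer model. [cite: CremonaAlgorithms1997, Table 1 (172A1)] -/
theorem M172A1_Δ : (⟨0, 1, 0, -13, 15⟩ : WeierstrassCurve ℤ).Δ = -11008 := by decide +kernel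
/-- `c₄(172a1) = 640` on the integer model. [cite: CremonaAlgorithms1997, Table 1 (172A1)] -/
theorem M172A1_c₄ : (⟨0, 1, 0, -13, 15⟩ : WeierstrassCurve ℤ).c₄ = 640 := by decide +kernel
/-- The integer model of `172a1` is Cremona's. [cite: SilvermanAEC2009, VIII.8] -/
theorem intModel_172A1 :
    haveI := isElliptic_172A1; haveI := isGloballyMinimal_172A1
    integralModelInt (⟨0, 1, 0, -13, 15⟩ : WeierstrassCurve ℚ) = (⟨0, 1, 0, -13, 15⟩ : WeierstrassCurve ℤ) :=
  haveI := isElliptic_172A1; haveI := isGloballyMinimal_172A1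
  integralModelInt_eq_of_map_eq _ (by ext <;> simp [WeierstrassCurve.map])

/-- The integer model base-changed to `ℚ` is the rational model. [folklore] -/
theorem baseChange_int_172A1 : (⟨0, 1, 0, -13, 15⟩ : WeierstrassCurve ℤ).baseChange ℚ = (⟨0, 1, 0, -13, 15⟩ : WeierstrassCurve ℚ) := by
  ext <;> simp [WeierstrassCurve.baseChange, WeierstrassCurve.map]

/-- `b₂, b₄, b₆` of `172a1`. [cite: SilvermanAEC2009, III.1] -/
theorem b_172A1 : (⟨0, 1, 0, -13, 15⟩ : WeierstrassCurve ℚ).b₂ = ((4 : ℤ) : ℚ) ∧ (⟨0, 1, 0, -13, 15⟩ : WeierstrassCurve ℚ).b₄ = ((-26 : ℤ) : ℚ) ∧ (⟨0, 1, 0, -13, 15⟩ : WeierstrassCurve ℚ).b₆ = ((60 : ℤ) : ℚ) := by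
  simp only [WeierstrassCurve.b₂, WeierstrassCurve.b₄, WeierstrassCurve.b₆]; norm_num

/-- **`E[2]` irreducible for `172a1`** (`E(ℚ)[2] = 0`; Cremona `#T = 1`): the monic `2`-division cubic has no root modulo `11`.
[cite: SilvermanAEC2009, III.2.3 (b)] [cite: KrizLi2019, Thm. 5.1 (hypothesis E(ℚ)[2] = 0)] -/
theorem irr_two_172A1 :
    haveI := isElliptic_172A1
    Irr (⟨0, 1, 0, -13, 15⟩ : WeierstrassCurve ℚ) 2 :=
  haveI := isElliptic_172A1
  irr_two_of_forall_cubic_ne _ b_172A1.1 b_172A1.2.1 b_172A1.2.2 (ℓ := 11) (by decide)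

/-- **`E(ℚ)[2] = 0` for `172a1`** in Kriz–Li's shape. [cite: KrizLi2019, Thm. 5.1 hypothesis "E(ℚ)[2] = 0"] -/
theorem twoTorsion_172A1 :
    haveI := isElliptic_172A1
    ∀ Q : (⟨0, 1, 0, -13, 15⟩ : WeierstrassCurve ℚ).toAffine.Point, 2 • Q = 0 → Q = 0 :=
  haveI := isElliptic_172A1
  (X5.O1.irr_two_iff_forall_two_nsmul _).mp irr_two_172A1

/-- **Tate certificate for `172a1` at `2`, kernel check** (Steps 1–8): translate by `(r,s,t) = (1,0,2)`; `2 ∣ a₁`, `2² ∣ a₂, a₃`, `2³ ∣ a₄`, `2⁴ ∣ a₆`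
and `(a₃/4)² + 4(a₆/16)` odd — Step 8 exit, type `IV*`, `v₂(Δ) = 8`. [cite: Silverman1994, IV.9.4 Steps 1–8] -/
theorem tateDeepCheck_two_172A1 : DeepCert.check ⟨2, 1, 0, 2, 8, 8, 0⟩ ⟨0, 1, 0, -13, 15⟩ = true := by
  decide +kernel

/-- **`172a1` has Kodaira type `IV*` and `ord₂ Δ_min = 8` at the place above `2`** (hypothesis-free form: `n = 8 < 12`). [cite: Silverman1994, IV.9.4 Step 8] -/
theorem kodairaSymbolAt_two_172A1 (v : HeightOneSpectrum (𝓞 ℚ)) (hv : natGenerator v = 2) :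
    (⟨0, 1, 0, -13, 15⟩ : WeierstrassCurve ℚ).kodairaSymbolAt v = .IVstar ∧ (⟨0, 1, 0, -13, 15⟩ : WeierstrassCurve ℚ).ordMinimalDiscriminant v = 8 := by
  have h := DeepCert.sound' (W₀ := ⟨0, 1, 0, -13, 15⟩) (c := ⟨2, 1, 0, 2, 8, 8, 0⟩) v hv tateDeepCheck_two_172A1
    (by decide +kernel)
  rw [baseChange_int_172A1] at h
  exact h

/-- **`f₂(172a1) = 2`** (Ogg: `8 + 1 − 7` components of `IV*`). [cite: Silverman1994, IV.11.1] -/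
theorem conductorExponent_two_172A1 (v : HeightOneSpectrum ℤ) (hv : natGenerator v = 2) :
    (⟨0, 1, 0, -13, 15⟩ : WeierstrassCurve ℚ).conductorExponent v = 2 := by
  have h := DeepCert.conductorExponent_int_eq' (W₀ := ⟨0, 1, 0, -13, 15⟩) (c := ⟨2, 1, 0, 2, 8, 8, 0⟩) v hv
    tateDeepCheck_two_172A1 (by decide +kernel)
  rw [baseChange_int_172A1] at h
  exact h

/-- **`172a1` is ADDITIVE at `2`** (`2 ∣ Δ`, `2 ∣ c₄` on the minimal model). [cite: SilvermanAEC2009, VII.5 Prop. 5.1 (c)] -/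
theorem addv_two_172A1 :
    haveI := isElliptic_172A1; haveI := isGloballyMinimal_172A1; haveI : Fact (Nat.Prime 2) := ⟨Nat.prime_two⟩
    Addv (⟨0, 1, 0, -13, 15⟩ : WeierstrassCurve ℚ) 2 := by
  haveI : Fact (Nat.Prime 2) := ⟨Nat.prime_two⟩
  haveI := isElliptic_172A1; haveI := isGloballyMinimal_172A1
  exact Additive.addv_of_intModel intModel_172A1 2 (by rw [M172A1_Δ]; decide) (by rw [M172A1_c₄]; decide)

/-- **`ord₂ j(172a1) = 13 ≥ 0`** (potentially good at `2`). [cite: SilvermanAEC2009, III.1 and VII.5 Prop. 5.5] -/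
theorem padicValRat_j_172A1 :
    haveI := isElliptic_172A1
    padicValRat 2 (⟨0, 1, 0, -13, 15⟩ : WeierstrassCurve ℚ).j = 13 := by
  haveI : Fact (Nat.Prime 2) := ⟨Nat.prime_two⟩
  haveI := isElliptic_172A1; haveI := isGloballyMinimal_172A1
  rw [AdditivePotMult.padicValRat_j_eq_of_intModel intModel_172A1 2 7 8 (by rw [M172A1_c₄]; decide) (by rw [M172A1_c₄]; decide)
    (by rw [M172A1_Δ]; decide) (by rw [M172A1_Δ]; decide)]
  norm_num

/-- **`c₂(172a1)` is ODD** (Kriz–Li: `c₂ = 3`): the local Tamagawa number divides the order `3` of the geometric component group of type `IV*`.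
[cite: KrizLi2019, Thm. 5.1 (hypothesis "c₂(E) odd") and §6 Table 1 (row 172a1: c₂ = 3)] [cite: Silverman1994, IV.9 Table 4.1 and Cor. 9.2] -/
theorem odd_localTamagawaNumber_two_172A1 :
    haveI := isElliptic_172A1; haveI : Fact (Nat.Prime 2) := ⟨Nat.prime_two⟩
    Odd (((⟨0, 1, 0, -13, 15⟩ : WeierstrassCurve ℚ).baseChange ℚ_[2]).localTamagawaNumber ℤ_[2]) := by
  haveI := isElliptic_172A1
  haveI : Fact (Nat.Prime 2) := ⟨Nat.prime_two⟩
  set v : HeightOneSpectrum (𝓞 ℚ) := (primesEquiv (R := 𝓞 ℚ)).symm ⟨2, Nat.prime_two⟩ with hv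
  have hv2 : (primesEquiv v : ℕ) = 2 := by rw [hv, Equiv.apply_symm_apply]
  have hgen : natGenerator v = 2 := hv2
  rw [localTamagawaNumber_padic_eq_holds (⟨0, 1, 0, -13, 15⟩ : WeierstrassCurve ℚ) v 2 hv2]
  have hdvd := localTamagawaNumber_dvd_componentGroupOrder v (⟨0, 1, 0, -13, 15⟩ : WeierstrassCurve ℚ) (nonempty_neronComponentData_holds _ v)
  rw [(kodairaSymbolAt_two_172A1 v hgen).1] at hdvd
  change _ ∣ 3 at hdvd
  rcases (Nat.dvd_prime Nat.prime_three).mp hdvd with h | h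
  · rw [h]; exact odd_one
  · rw [h]; exact ⟨1, rfl⟩

/-- **`172a1` is non-CM**: multiplicative at `43` (`43 ∣ Δ`, `43 ∤ c₄ = 640`), so `ord_43 j < 0`. [cite: SilvermanAEC2009, App. C §11] -/
theorem not_hasCM_172A1 :
    haveI := isElliptic_172A1
    ¬ (⟨0, 1, 0, -13, 15⟩ : WeierstrassCurve ℚ).HasCM := by
  haveI := isElliptic_172A1; haveI := isGloballyMinimal_172A1
  haveI : Fact (Nat.Prime 43) := ⟨by norm_num⟩
  exact AdditivePotMult.not_hasCM_of_padicValRat_j_neg (p := 43) (EisensteinPrimes.padicValRat_j_neg_of_mult _ 43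
    (hasMultiplicativeReductionAtPrime_of_intModel intModel_172A1 43 (by rw [M172A1_Δ]; decide) (by rw [M172A1_c₄]; decide)))

/-- **`1 ≤ rank_ℤ 172a1(ℚ)` IN THE KERNEL**: the rational point `2·P = (49 / 9, -314 / 27)` has `3` in its denominator, so it has infinite order (kind `NL`,
Silverman VII.3.4, tree `one_le_mordellWeilRank_of_dvd_den`). [cite: SilvermanAEC2009, VII.3.4 and Thm. VIII.6.7] [cite: CremonaAlgorithms1997, Table 1 (172A1: r = 1)] -/
theorem one_le_mordellWeilRank_172A1 :
    haveI := isElliptic_172A1; haveI := isGloballyMinimal_172A1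
    1 ≤ (⟨0, 1, 0, -13, 15⟩ : WeierstrassCurve ℚ).mordellWeilRank :=
  haveI := isElliptic_172A1; haveI := isGloballyMinimal_172A1
  haveI : Fact (Nat.Prime 3) := ⟨by norm_num⟩
  one_le_mordellWeilRank_of_dvd_den (⟨0, 1, 0, -13, 15⟩ : WeierstrassCurve ℚ) 3 (by norm_num) (x := 49 / 9) (y := -314 / 27)
    (WeierstrassCurve.Affine.equation_iff_nonsingular.mp (by rw [WeierstrassCurve.Affine.equation_iff]; norm_num))
    (by norm_num)

/-- **`N(172a1) ∣ |Δ_min| = 11008`.** [cite: SilvermanAEC2009, VIII.11 and C.16] -/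
theorem conductorNorm_dvd_172A1 :
    haveI := isElliptic_172A1
    (⟨0, 1, 0, -13, 15⟩ : WeierstrassCurve ℚ).conductorNorm ℤ ∣ 11008 := by
  haveI := isElliptic_172A1; haveI := isGloballyMinimal_172A1
  have hdvd := WeierstrassCurve.conductorNorm_dvd_minimalDiscriminantNorm (⟨0, 1, 0, -13, 15⟩ : WeierstrassCurve ℚ)
    (WeierstrassCurve.finite_setOf_ordMinimalDiscriminant_ne_zero_holds _)
  rw [WeierstrassCurve.minimalDiscriminantNorm_int_eq_natAbs_minimalDiscriminantInt_holds,
    minimalDiscriminantInt_eq intModel_172A1, M172A1_Δ] at hdvd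
  exact hdvd

/-- **`ord₂ N(172a1) = 2`, `ord_43 N(172a1) = 1`** (the latter: multiplicative at `43`, `43 ∣ Δ`, `43 ∤ c₄`). [cite: Silverman1994, IV.11.1] -/
theorem factorization_conductorNorm_172A1 :
    haveI := isElliptic_172A1
    (((⟨0, 1, 0, -13, 15⟩ : WeierstrassCurve ℚ).conductorNorm ℤ).factorization 2 = 2) ∧ (((⟨0, 1, 0, -13, 15⟩ : WeierstrassCurve ℚ).conductorNorm ℤ).factorization 43 = 1) := by
  haveI := isElliptic_172A1; haveI := isGloballyMinimal_172A1
  haveI hE : ((⟨0, 1, 0, -13, 15⟩ : WeierstrassCurve ℤ).baseChange ℚ).IsElliptic := by rw [baseChange_int_172A1]; infer_instance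
  have hq : Nat.Prime 43 := by norm_num
  refine ⟨?_, ?_⟩
  · rw [show (2 : ℕ) = ((⟨2, Nat.prime_two⟩ : Nat.Primes) : ℕ) from rfl, factorization_conductorNorm_primesEquiv_symm]
    exact conductorExponent_two_172A1 _ (congrArg Subtype.val ((primesEquiv (R := ℤ)).apply_symm_apply ⟨2, Nat.prime_two⟩))
  · set v : HeightOneSpectrum ℤ := (primesEquiv (R := ℤ)).symm ⟨43, hq⟩ with hv
    have hgen : natGenerator v = 43 := congrArg Subtype.val ((primesEquiv (R := ℤ)).apply_symm_apply ⟨43, hq⟩)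
    have hmin : ((⟨0, 1, 0, -13, 15⟩ : WeierstrassCurve ℤ).baseChange ℚ).IsMinimalAt v := by
      rw [baseChange_int_172A1]; exact IsGloballyMinimal.isMinimalAt_int _ v
    have h1 : ((⟨0, 1, 0, -13, 15⟩ : WeierstrassCurve ℤ).baseChange ℚ).conductorExponent v = 1 :=
      conductorExponent_eq_one_of_dvd_Δ_of_not_dvd_c₄ hmin (by rw [hgen, M172A1_Δ]; decide) (by rw [hgen, M172A1_c₄]; decide)
    rw [baseChange_int_172A1] at h1
    rw [show (43 : ℕ) = ((⟨43, hq⟩ : Nat.Primes) : ℕ) from rfl, factorization_conductorNorm_primesEquiv_symm]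
    exact h1

/-- The prime factorisation of `2ᵃ·43ᵇ`, read coefficientwise. [folklore] -/
theorem factorization_2_pow_mul_43_pow_172A1 (a b r : ℕ) :
    (2 ^ a * 43 ^ b).factorization r = if r = 2 then a else if r = 43 then b else 0 := by
  have hp : Nat.Prime 2 := by norm_num
  have hq : Nat.Prime 43 := by norm_num
  rw [Nat.factorization_mul (pow_ne_zero _ hp.ne_zero) (pow_ne_zero _ hq.ne_zero), Finsupp.add_apply,
    Nat.factorization_pow, Nat.factorization_pow, Finsupp.smul_apply, Finsupp.smul_apply, hp.factorization, hq.factorization,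
    Finsupp.single_apply, Finsupp.single_apply]
  by_cases hrp : r = 2
  · subst hrp; simp
  by_cases hrq : r = 43
  · subst hrq; simp
  · simp [Ne.symm hrp, Ne.symm hrq, hrp, hrq]

/-- **`N(172a1) = 172 = 2²·43` IN THE KERNEL** (`N ∣ 2^8·43^1`, `ord₂ N = 2`, `ord_43 N = 1`). [cite: CremonaAlgorithms1997, Table 1 (172A1)] -/
theorem conductorNorm_172A1 :
    haveI := isElliptic_172A1
    (⟨0, 1, 0, -13, 15⟩ : WeierstrassCurve ℚ).conductorNorm ℤ = 172 := by
  haveI := isElliptic_172A1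
  set N := (⟨0, 1, 0, -13, 15⟩ : WeierstrassCurve ℚ).conductorNorm ℤ with hN
  have hN0 : N ≠ 0 := (conductorNorm_pos_holds _).ne'
  obtain ⟨hp1, hq1⟩ := factorization_conductorNorm_172A1
  have hle := (Nat.factorization_le_iff_dvd hN0 (by norm_num : (11008 : ℕ) ≠ 0)).mpr conductorNorm_dvd_172A1
  have eN : (172 : ℕ) = 2 ^ 2 * 43 ^ 1 := by norm_num
  have eΔ : (11008 : ℕ) = 2 ^ 8 * 43 ^ 1 := by norm_num
  refine Nat.eq_of_factorization_eq hN0 (by norm_num) fun r => ?_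
  rw [eN, factorization_2_pow_mul_43_pow_172A1]
  by_cases hrp : r = 2
  · subst hrp; rw [hp1]; simp
  by_cases hrq : r = 43
  · subst hrq; rw [hq1]; simp
  have hr' := hle r
  rw [eΔ, factorization_2_pow_mul_43_pow_172A1, if_neg hrp, if_neg hrq] at hr'
  rw [if_neg hrp, if_neg hrq]
  exact Nat.le_zero.mp hr'

/-- **`N(172a1) < 5000`** (Creutz–Miller's range). [cite: CreutzMiller2012, Thm. 1.1] -/
theorem conductorNorm_lt_5000_172A1 :
    haveI := isElliptic_172A1
    (⟨0, 1, 0, -13, 15⟩ : WeierstrassCurve ℚ).conductorNorm ℤ < 5000 := by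
  rw [conductorNorm_172A1]; norm_num

/-- **Kriz–Li's local hypotheses at `2` for `172a1`**: `c₂` odd (kernel: type `IV*`) and — `E` being ADDITIVE at `2` — the Manin constant `Dt.c` of the OPTIMAL
datum odd, by print (Agashe–Ribet–Stein Thm. 2.6 / Cremona: `|c| = 1` at level `≤ 130000`, `h26`).
[cite: KrizLi2019, Thm. 5.1 hypotheses "c₂(E) odd; Manin constant odd if additive at 2"] [cite: AgasheRibetStein2006, Thm. 2.6] -/
theorem krizLi_loc_172A1 (h26 : cremona_abs_maninConstant_eq_one_of_level_le)
    [haveI := isElliptic_172A1; NeZero ((⟨0, 1, 0, -13, 15⟩ : WeierstrassCurve ℚ).conductorNorm ℤ)]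
    (Dt : haveI := isElliptic_172A1; ModularParametrizationData (⟨0, 1, 0, -13, 15⟩ : WeierstrassCurve ℚ) ((⟨0, 1, 0, -13, 15⟩ : WeierstrassCurve ℚ).conductorNorm ℤ))
    (hopt : haveI := isElliptic_172A1; Zhai2021.IsOptimalDatum (⟨0, 1, 0, -13, 15⟩ : WeierstrassCurve ℚ) Dt) :
    haveI := isElliptic_172A1; haveI : Fact (2 : ℕ).Prime := ⟨Nat.prime_two⟩
    Odd (((⟨0, 1, 0, -13, 15⟩ : WeierstrassCurve ℚ).baseChange ℚ_[2]).localTamagawaNumber ℤ_[2]) ∧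
      (¬ (⟨0, 1, 0, -13, 15⟩ : WeierstrassCurve ℚ).HasGoodReductionAtPrime 2 → ¬ (⟨0, 1, 0, -13, 15⟩ : WeierstrassCurve ℚ).HasMultiplicativeReductionAtPrime 2 → Odd Dt.c) := by
  haveI := isElliptic_172A1; haveI := isGloballyMinimal_172A1
  refine ⟨odd_localTamagawaNumber_two_172A1, fun _ _ => ?_⟩
  have hc : ¬ (2 : ℤ) ∣ Dt.c := not_two_dvd_c_of_level_le h26 _ Dt hopt (by rw [conductorNorm_172A1]; norm_num)
  exact Int.not_even_iff_odd.mp fun h => hc (even_iff_two_dvd.mp h)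

/-- **The Heegner hypothesis for `(172a1, K)`, `d_K = -7`**: the primes `2`, `43` of `N = 172` split in `K` (`d_K ≡ 1 (mod 8)`, `(-7/43) = 1`).
[cite: KrizLi2019, Thm. 5.1 hypothesis "K satisfies the Heegner hypothesis for N"] [cite: Marcus1977, Ch. 3 Thm. 25] -/
theorem satisfiesHeegnerHypothesis_172A1 {K : Type} [Field K] [NumberField K] (h2 : Module.finrank ℚ K = 2)
    (hdK : NumberField.discr K = -7) :
    haveI := isElliptic_172A1
    SatisfiesHeegnerHypothesis ((⟨0, 1, 0, -13, 15⟩ : WeierstrassCurve ℚ).conductorNorm ℤ) K := by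
  rw [conductorNorm_172A1, satisfiesHeegnerHypothesis_iff_kronecker _ K h2, hdK]
  intro r hr hrN
  have hrN' : r ∣ 2 ^ 2 * 43 := by norm_num at hrN ⊢; exact hrN
  rcases (Nat.Prime.dvd_mul hr).mp hrN' with h | h
  · obtain rfl := (Nat.prime_dvd_prime_iff_eq hr Nat.prime_two).mp (hr.dvd_of_dvd_pow h)
    exact ⟨fun _ => by decide, fun h => absurd rfl h⟩
  · obtain rfl := (Nat.prime_dvd_prime_iff_eq hr (by norm_num)).mp h
    exact ⟨fun h => absurd h (by norm_num), fun _ => by norm_num⟩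

/-- **`#Ẽ(𝔽_11) = 15` for `172a1`** (certified count), so `a_11 = -3`. [cite: SilvermanAEC2009, V.2] -/
theorem reductionPointCount_11_172A1 :
    haveI := isGloballyMinimal_172A1
    (⟨0, 1, 0, -13, 15⟩ : WeierstrassCurve ℚ).reductionPointCount 11 = 15 := by
  haveI : Fact (Nat.Prime 11) := ⟨by norm_num⟩
  haveI := isElliptic_172A1; haveI := isGloballyMinimal_172A1
  exact Supersingular.reductionPointCount_eq_of_intModel_countPoints intModel_172A1 11 (by norm_num) (by decide +kernel)
    (by decide +kernel)

/-- **`a_11(172a1)` is odd** (`Frob_11` has order `3` on `E[2]`). [cite: KrizLi2019, Def. 4.1 ("Frob_ℓ of order 3")] -/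
theorem odd_frobeniusTrace_11_172A1 :
    haveI := isGloballyMinimal_172A1
    Odd ((⟨0, 1, 0, -13, 15⟩ : WeierstrassCurve ℚ).frobeniusTrace 11) := by
  haveI := isGloballyMinimal_172A1
  rw [Uniform.U2.odd_frobeniusTrace_iff_odd_reductionPointCount _ (by norm_num : Nat.Prime 11) (by norm_num),
    reductionPointCount_11_172A1]
  decide

end Base172A1


end Summit.BirchSwinnertonDyer.BirchSwinnertonDyer.Theorems.GenusExact.TwinSwap.KrizLiAnchor172a1

end
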